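import Summits.CriticalPhenomena.SAWScalingLimit.Theorems.LeftRightFKG.Negative.BoxMesh
import Summits.CriticalPhenomena.SAWScalingLimit.Theorems.BoundaryTP2Negative_Box3
import Summits.CriticalPhenomena.SAWScalingLimit.Theorems.SAWLeftRightFKGNotFKGAtOneWindBox

/-!
# The discrete domain of a 3 × 3 box (line `three-by-three-corner-witness`, stub `stub_meshBox`)

Crux `stmt-CriticalPhenomena-11233`
(`Summit.CriticalPhenomena.SAWScalingLimit.Theses.SAWLeftRightFKG.NotFKGAtOne`, the negative guard of route
`SAWLeftRightFKG`: left–right positive association fails for the COUNTING measure), line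
`three-by-three-corner-witness` (skeleton `Cruxes/NotFKGAtOne/Lines/three_by_three_corner_witness.lean`),
registered stub `stub_meshBox` — the combinatorial half of the domain identification.

**`stub_meshBox`**: for ANY plane set `Ω` containing the open square `(-1,3)²` whose mesh-`1` vertices are
exactly the box `{0,1,2}² = boxSites (0,0) (2,2)`, adjacency in the discrete domain graph
`Ω_1 = discreteDomainGraph Ω 1` (mesh edges = unit segments in `closure Ω`, restricted to the LARGEST
component) is lattice adjacency inside the box — the exact shape of the tree's `BoundaryTP2.Negative.adj₃_iff`.

Proof (replay of the landed `LeftRightFKG/Negative/BoxMesh.lean`, the `5 × 4` box, at `3 × 3`): unit segments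
between box sites lie in the convex open square `⊆ Ω ⊆ closure Ω` (`meshGraph_adj_of_box₃`, convexity
`convex_Rint₃` from the sibling stub file `SAWLeftRightFKGNotFKGAtOneWindBox`); the induced
mesh graph on the nine box sites is connected by row/column induction from `(0,0)`
(`meshVertexGraph_preconnected_of_box₃`), so the largest component is everything
(`Literature.Probability.Percolation.meshDomain_eq_meshVertices_of_preconnected`, `meshDomain_eq_of_box₃`);
then `discreteDomainGraph_adj_iff` + `meshGraph_le_zdGraph`.  Everything here is elementary ("folklore");
no definitions.
-/

noncomputable section

open Set Complex Literature.Probability.LatticeModels Literature.Probability.RandomPlanarGeometry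
open Summit.CriticalPhenomena.SAWScalingLimit.Theorems.LeftRightFKG.Negative
  (bx bx_zero bx_one eq_bx adj_bx pt pt_re pt_im)

namespace Summit.CriticalPhenomena.SAWScalingLimit.Theorems.NotFKGAtOne

section MeshBox

variable {Ω : Set ℂ}

/-- Coordinate bounds of a box site. [folklore] -/
theorem bounds_of_mem_box₃ {v : Site 2} (hv : v ∈ boxSites ![0, 0] ![2, 2]) :
    (0 ≤ v 0 ∧ v 0 ≤ 2) ∧ (0 ≤ v 1 ∧ v 1 ≤ 2) := by
  rw [mem_boxSites_iff, Fin.forall_fin_two] at hv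
  simpa using hv

/-- Explicit sites of the box. [folklore] -/
theorem bx_mem_box₃ {i j : ℤ} (hi : 0 ≤ i ∧ i ≤ 2) (hj : 0 ≤ j ∧ j ≤ 2) :
    bx i j ∈ boxSites ![0, 0] ![2, 2] := by
  rw [mem_boxSites_iff, Fin.forall_fin_two]
  simpa [bx] using And.intro hi hj

/-- Box sites lie in the open square `(-1,3)²`. [folklore] -/
theorem pt_mem_openSq_of_box {x : Site 2} (hx : x ∈ boxSites ![0, 0] ![2, 2]) :
    pt x ∈ {z : ℂ | (-1 < z.re ∧ z.re < 3) ∧ (-1 < z.im ∧ z.im < 3)} := by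
  obtain ⟨⟨h1, h2⟩, h3, h4⟩ := bounds_of_mem_box₃ hx
  simp only [mem_setOf_eq, pt_re, pt_im]
  have i1 : (0 : ℝ) ≤ x 0 := by exact_mod_cast h1
  have i2 : (x 0 : ℝ) ≤ 2 := by exact_mod_cast h2
  have i3 : (0 : ℝ) ≤ x 1 := by exact_mod_cast h3
  have i4 : (x 1 : ℝ) ≤ 2 := by exact_mod_cast h4
  exact ⟨⟨by linarith, by linarith⟩, by linarith, by linarith⟩

/-- Lattice neighbours inside the box are mesh-adjacent, for any `Ω` containing the open square (the unit
segment lies in the convex open square `⊆ Ω ⊆ closure Ω`). [folklore] -/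
theorem meshGraph_adj_of_box₃ (hR : {z : ℂ | (-1 < z.re ∧ z.re < 3) ∧ (-1 < z.im ∧ z.im < 3)} ⊆ Ω)
    {x y : Site 2} (hx : x ∈ boxSites ![0, 0] ![2, 2]) (hy : y ∈ boxSites ![0, 0] ![2, 2])
    (h : (zdGraph 2).Adj x y) : (meshGraph Ω 1).Adj x y := by
  refine meshGraph_adj_iff.2 ⟨h, ?_⟩
  rw [meshPoint_one, meshPoint_one]
  exact (convex_Rint₃.segment_subset (pt_mem_openSq_of_box hx) (pt_mem_openSq_of_box hy)).trans
    (hR.trans subset_closure)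

/-- **The mesh graph on the box is connected** (row/column induction from `(0,0)`), for any `Ω` containing
the open square whose mesh vertices are the box. [folklore] -/
theorem meshVertexGraph_preconnected_of_box₃
    (hR : {z : ℂ | (-1 < z.re ∧ z.re < 3) ∧ (-1 < z.im ∧ z.im < 3)} ⊆ Ω)
    (hV : meshVertices Ω 1 = boxSites ![0, 0] ![2, 2]) : (meshVertexGraph Ω 1).Preconnected := by
  set G := meshVertexGraph Ω 1 with hG
  have h00 : bx 0 0 ∈ meshVertices Ω 1 := by
    rw [hV]; exact bx_mem_box₃ (by norm_num) (by norm_num)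
  have hrow : ∀ k : ℕ, k ≤ 2 →
      ∃ h : bx k 0 ∈ meshVertices Ω 1, G.Reachable ⟨bx 0 0, h00⟩ ⟨bx k 0, h⟩ := by
    intro k hk
    induction k with
    | zero => exact ⟨by exact_mod_cast h00, by exact_mod_cast SimpleGraph.Reachable.refl _⟩
    | succ k ih =>
      obtain ⟨hk', hr⟩ := ih (Nat.le_of_succ_le hk)
      have hmem : bx (k + 1 : ℕ) 0 ∈ meshVertices Ω 1 := by
        rw [hV]; exact bx_mem_box₃ ⟨by positivity, by exact_mod_cast hk⟩ ⟨le_rfl, by norm_num⟩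
      refine ⟨hmem, hr.trans (SimpleGraph.Adj.reachable ?_)⟩
      simp only [hG, SimpleGraph.comap_adj, Function.Embedding.coe_subtype]
      exact meshGraph_adj_of_box₃ hR (hV ▸ hk') (hV ▸ hmem)
        (adj_bx _ _ _ _ (Or.inl ⟨by push_cast; ring, rfl⟩))
  have hcol : ∀ (i k : ℕ), i ≤ 2 → k ≤ 2 →
      ∃ h : bx i k ∈ meshVertices Ω 1, G.Reachable ⟨bx 0 0, h00⟩ ⟨bx i k, h⟩ := by
    intro i k hi hk
    induction k with
    | zero => obtain ⟨h, hr⟩ := hrow i hi; exact ⟨by exact_mod_cast h, by exact_mod_cast hr⟩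
    | succ k ih =>
      obtain ⟨hk', hr⟩ := ih (Nat.le_of_succ_le hk)
      have hmem : bx i (k + 1 : ℕ) ∈ meshVertices Ω 1 := by
        rw [hV]
        exact bx_mem_box₃ ⟨by positivity, by exact_mod_cast hi⟩ ⟨by positivity, by exact_mod_cast hk⟩
      refine ⟨hmem, hr.trans (SimpleGraph.Adj.reachable ?_)⟩
      simp only [hG, SimpleGraph.comap_adj, Function.Embedding.coe_subtype]
      exact meshGraph_adj_of_box₃ hR (hV ▸ hk') (hV ▸ hmem)
        (adj_bx _ _ _ _ (Or.inr (Or.inr (Or.inl ⟨by push_cast; ring, rfl⟩))))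
  have hreach : ∀ v : meshVertices Ω 1, G.Reachable ⟨bx 0 0, h00⟩ v := by
    rintro ⟨v, hv⟩
    have hv' := hv
    rw [hV] at hv'
    obtain ⟨⟨h1, h2⟩, h3, h4⟩ := bounds_of_mem_box₃ hv'
    obtain ⟨i, hi⟩ : ∃ i : ℕ, (i : ℤ) = v 0 := ⟨(v 0).toNat, Int.toNat_of_nonneg h1⟩
    obtain ⟨k, hk⟩ : ∃ k : ℕ, (k : ℤ) = v 1 := ⟨(v 1).toNat, Int.toNat_of_nonneg h3⟩
    have hiL : i ≤ 2 := by omega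
    have hkL : k ≤ 2 := by omega
    obtain ⟨h, hr⟩ := hcol i k hiL hkL
    have heq : bx i k = v := by rw [eq_bx v, ← hi, ← hk]
    have hsub : (⟨v, hv⟩ : meshVertices Ω 1) = ⟨bx i k, h⟩ := Subtype.ext heq.symm
    rw [hsub]
    exact hr
  exact fun u v => (hreach u).symm.trans (hreach v)

/-- **The discrete domain of such an `Ω` is the whole box** (a connected mesh graph is its own largest
component). [folklore] -/
theorem meshDomain_eq_of_box₃ (hR : {z : ℂ | (-1 < z.re ∧ z.re < 3) ∧ (-1 < z.im ∧ z.im < 3)} ⊆ Ω)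
    (hV : meshVertices Ω 1 = boxSites ![0, 0] ![2, 2]) : meshDomain Ω 1 = boxSites ![0, 0] ![2, 2] := by
  rw [Literature.Probability.Percolation.meshDomain_eq_meshVertices_of_preconnected
    (meshVertexGraph_preconnected_of_box₃ hR hV), hV]

end MeshBox

/-- **STUB `stub_meshBox` of line `three-by-three-corner-witness` (crux `NotFKGAtOne`).**  For ANY `Ω ⊆ ℂ`
containing the open square `(-1,3)²` whose mesh-`1` vertices are exactly the box `{0,1,2}²`, adjacency in
`discreteDomainGraph Ω 1` is lattice adjacency inside the box (both directions). [folklore] -/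
theorem stub_meshBox :
    ∀ Ω : Set ℂ, {z : ℂ | (-1 < z.re ∧ z.re < 3) ∧ (-1 < z.im ∧ z.im < 3)} ⊆ Ω →
      meshVertices Ω 1 = boxSites ![0, 0] ![2, 2] →
      ∀ x y : Site 2, (discreteDomainGraph Ω 1).Adj x y ↔
        (zdGraph 2).Adj x y ∧ x ∈ boxSites ![0, 0] ![2, 2] ∧ y ∈ boxSites ![0, 0] ![2, 2] := by
  intro Ω hR hV x y
  rw [discreteDomainGraph_adj_iff, meshDomain_eq_of_box₃ hR hV]
  constructor
  · rintro ⟨h, hx, hy⟩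
    exact ⟨meshGraph_le_zdGraph _ _ h, hx, hy⟩
  · rintro ⟨h, hx, hy⟩
    exact ⟨meshGraph_adj_of_box₃ hR hx hy h, hx, hy⟩

end Summit.CriticalPhenomena.SAWScalingLimit.Theorems.NotFKGAtOne

end
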